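import Summits.QuantumFields.YangMills.Theorems.BalabanUVNodesN15KingModelLandauFibre
import Summits.QuantumFields.YangMills.Theorems.BalabanUVNodesN15KingModelCurvatureHarper
import HarnessLib

/-!
# BalabanUVNodes ∕ N15 — THE KING-MODEL RUNG (PART Ϡ-h): THE LANDAU LEVEL OF EVERY HARPER FIBRE — for PART Ϳ-n's Harper ∕ Hofstadter operator `H_{p,q}` on `ℤ∕K_{ν₀}` (King's covariant
# fine operator at constant flux restricted to the transverse plane-wave sector `q`): `Re⟨f, H_{p,q}f⟩ = m²‖f‖² + c(Σ|∇f|² + Σ_j(2−2Re ζ_j)|f_j|² + T(q)‖f‖²)` with Landau phases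
# `ζ_j = χ(p₀j)χ_q(e_{ν₁})` and transverse kinetic energy `T(q) = Σ_{μ∉{ν₀,ν₁}}(2 − 2cos q′_μ) ≥ 0`, hence `Re⟨f,H_{p,q}f⟩ ≥ (m² + c·T(q) + c·Λ(p′_{ν₀}))‖f‖²` — EVERY fibre of the
# Hofstadter problem on King's torus sits above the lattice Landau level `c·Λ(θ)`, uniformly in `q`
# (Track A, DAG node N15 = NE2; FAN-OUT v1.1 §N15 s3 «KING-MODEL RUNG … + what the curved case adds»; count-neutral)

HONEST FRAMING.  Count-neutral (cell `pub-ymgap`, seat `pub-ymgap-dag-n15-e` g47; `--supports stmt-QuantumFields-27247 --as helper` = K3ᴬ, KEY MAP v3).  One-dimensional algebra on the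
fibre operator of PART Ϳ-n (`harperOp`, [King1986] (4.4) p.670 in mixed position ∕ momentum variables; Harper ∕ Hofstadter notion only) plus PART Ϡ-a's fibre bound.  NOT Bałaban's
`G_k(U)`; NOT a node discharge; nothing continuum ∕ ℝ⁴ ∕ OS ∕ Clay.

THE RESULTS (`N = K_{ν₀} ≥ 1`, any `p, q ∈ Tor K`, `f : ℤ∕N → ℂ`, `ψ = stdAddChar`):
* §1 pointwise real-part bookkeeping: `norm_sub_sq_eq`, `re_conj_mul_harper_shape` (the real part of `F̄·(AF − c((P+M) + (Z+Z̄)F + RF))` in components), `sum_re_conj_mul_pred` (re-indexing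
  `j−1 ↦ j`), ★ `sum_norm_sq_fwdDiff_eq` (`Σ|f(j+1)−f(j)|² = 2Σ|f|² − 2ΣRe(f̄_jf_{j+1})`); dry-run v1 `dedup.landed` ×2 (`re_conj_mul_self`∕`re_conj_mul_symm` exist in other Literature areas) ⇒ inlined.
* §2 ★★ **`re_form_harperOp_eq`** (`ν₀ ≠ ν₁`): `Re Σ_j f̄_j(H_{p,q}f)_j = m²S + c(Σ|∇f|² + Σ(2−2Re ζ_j)|f_j|² + T(q)S)`, `S = Σ|f_j|²`, `ζ_j = ψ(p_{ν₀}j)χ_q(e_{ν₁})`,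
  `T(q) = Σ_{μ∉{ν₀,ν₁}}(2 − 2Re χ_q(e_μ))`; `transverseKinetic_nonneg` (`T(q) ≥ 0`), `transverseKinetic_eq_cos` (`= Σ(2 − 2cos q′_μ)`).
* §3 ★★★ **`re_form_harperOp_ge_landau`**: `(m² + c·T(q) + c·Λ(p′_{ν₀}))·Σ|f_j|² ≤ Re Σ_j f̄_j(H_{p,q}f)_j` (`c ≥ 0`; Ϡ-a `landau_fibre_bound_gap` with `ω = ψ(p_{ν₀}) = e^{ip′_{ν₀}}`), ★★
  `re_form_harperOp_ge_landau'` (the `q`-uniform floor `m² + cΛ(p′_{ν₀})`).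
WHY (rung bookkeeping).  PART Ϳ-n decided the STRUCTURE (fibration over transverse momenta); PART Ϡ-b∕c decided the torus operator's bottom directly.  This file closes the triangle: the
bound holds fibre by fibre, with the transverse kinetic energy displayed — the lattice shadow of `E = (n+½)·2B + p_∥²` (Landau levels plus free motion along the field).
PRIOR TREE ART (by name): Ϳ-n (`harperOp`), Ϡ-a (`landauGap`, `landau_fibre_bound_gap`, `norm_sq_one_sub_of_norm_eq_one`), `TorusSpectral.norm_chi_eq_one`, `B5Prop11Plancherel` (`Tor`, `unitVec`, `chi`,
`chi_unitVec`, `sOf`), `King1986.Torus.chi_unitVec_eq_exp`, Mathlib (`Complex.re_sum`, `Complex.mul_re`, `Finset.card_erase_of_mem`).  Dedup (rg at filing): basename 0 files; needles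
`re_form_harperOp|transverseKinetic|sum_norm_sq_fwdDiff_eq|sum_re_conj_mul_pred|re_conj_mul_harper_shape` 0 tree files.  Locators: [King1986] (4.4) p.670, (4.35) p.674; [Harper1955] Proc. Phys. Soc. A 68 (notion);
[LandauLifshitzQM] §112 (notion).  0 `sorry`, 0 `def`.
-/

noncomputable section
open scoped BigOperators ComplexConjugate
open Finset

namespace Summit.QuantumFields.YangMills.BalabanUVNodes.N15KingModelRung.Landau

open Literature.MathematicalPhysics.QuantumFieldTheory.Balaban1983to89.B5Prop11Plancherel (Tor unitVec chi chi_unitVec sOf)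
open Literature.MathematicalPhysics.QuantumFieldTheory.King1986.Torus (chi_unitVec_eq_exp)
open Summit.QuantumFields.YangMills.BalabanUVNodes.N15KingModelRung.TorusSpectral (norm_chi_eq_one)
open Summit.QuantumFields.YangMills.BalabanUVNodes.N15KingModelRung.Curvature (harperOp)

/-! ## §1 Real-part bookkeeping on the cycle -/

section Pointwise

/-- THE HARPER SHAPE, real part: `Re(F̄·(A·F − c((P+M) + (Z+Z̄)F + R·F))) = A|F|² − c(Re(F̄P) + Re(F̄M) + 2Re Z·|F|² + Re R·|F|²)` for complex `F P M Z R`, real `A c`. [folklore] -/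
theorem re_conj_mul_harper_shape (F P M Z R : ℂ) (A c : ℝ) :
    (conj F * ((A : ℂ) * F - (c : ℂ) * ((P + M) + (Z + conj Z) * F + R * F))).re
      = A * ‖F‖ ^ 2 - c * ((conj F * P).re + (conj F * M).re + 2 * Z.re * ‖F‖ ^ 2 + R.re * ‖F‖ ^ 2) := by
  simp only [Complex.sq_norm, Complex.normSq_apply, Complex.mul_re, Complex.mul_im, Complex.sub_re, Complex.sub_im, Complex.add_re, Complex.add_im, Complex.conj_re,
    Complex.conj_im, Complex.ofReal_re, Complex.ofReal_im]
  ring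

/-- `|a − b|² = |a|² + |b|² − 2Re(b̄·a)`. [folklore] -/
theorem norm_sub_sq_eq (a b : ℂ) : ‖a - b‖ ^ 2 = ‖a‖ ^ 2 + ‖b‖ ^ 2 - 2 * (conj b * a).re := by
  simp only [Complex.sq_norm, Complex.normSq_apply, Complex.sub_re, Complex.sub_im, Complex.mul_re, Complex.conj_re, Complex.conj_im]
  ring

variable {N : ℕ} [NeZero N]

/-- Re-indexing: `Σ_j Re(f̄_j f_{j−1}) = Σ_j Re(f̄_j f_{j+1})`. [folklore] -/
theorem sum_re_conj_mul_pred (f : ZMod N → ℂ) : ∑ j, (conj (f j) * f (j - 1)).re = ∑ j, (conj (f j) * f (j + 1)).re := by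
  -- `Re(ā·b) = Re(b̄·a)` termwise (the tree's `re_conj_mul_comm`, kept inline)
  rw [show (∑ j, (conj (f j) * f (j + 1)).re) = ∑ j, (conj (f (j + 1)) * f j).re from
    Finset.sum_congr rfl fun j _ => by simp only [Complex.mul_re, Complex.conj_re, Complex.conj_im]; ring]
  exact (Fintype.sum_equiv (Equiv.addRight 1) (fun j => (conj (f (j + 1)) * f j).re) (fun j => (conj (f j) * f (j - 1)).re) fun j => by simp).symm

/-- ★ `Σ_j|f(j+1) − f(j)|² = 2Σ_j|f_j|² − 2Σ_jRe(f̄_jf_{j+1})`. [folklore] -/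
theorem sum_norm_sq_fwdDiff_eq (f : ZMod N → ℂ) : ∑ j, ‖f (j + 1) - f j‖ ^ 2 = 2 * ∑ j, ‖f j‖ ^ 2 - 2 * ∑ j, (conj (f j) * f (j + 1)).re := by
  simp_rw [norm_sub_sq_eq]
  rw [Finset.sum_sub_distrib, Finset.sum_add_distrib, ← Finset.mul_sum,
    show ∑ j, ‖f (j + 1)‖ ^ 2 = ∑ j, ‖f j‖ ^ 2 from Fintype.sum_equiv (Equiv.addRight 1) _ _ fun j => by simp]
  ring

end Pointwise

/-! ## §2 The real form of the Harper fibre -/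

section Form

variable {d : ℕ} (K : Fin (d + 1) → ℕ) [hK : ∀ μ, NeZero (K μ)]

/-- The transverse directions `μ ∉ {ν₀, ν₁}` are `d − 1` in number (`ν₀ ≠ ν₁`). [folklore] -/
theorem card_rest {ν₀ ν₁ : Fin (d + 1)} (hν : ν₀ ≠ ν₁) : (((Finset.univ.erase ν₀).erase ν₁).card : ℝ) = (d : ℝ) + 1 - 2 := by
  have h1 : ((Finset.univ : Finset (Fin (d + 1))).erase ν₀).card = d := by rw [Finset.card_erase_of_mem (Finset.mem_univ _), Finset.card_univ, Fintype.card_fin]; rfl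
  have hmem : ν₁ ∈ (Finset.univ : Finset (Fin (d + 1))).erase ν₀ := Finset.mem_erase.mpr ⟨Ne.symm hν, Finset.mem_univ _⟩
  have h2 := Finset.card_erase_of_mem hmem
  rw [h1] at h2
  have hd : 1 ≤ d := by
    have := Finset.card_pos.mpr ⟨ν₁, hmem⟩; rw [h1] at this; exact this
  rw [h2, Nat.cast_sub hd]; push_cast; ring

/-- THE TRANSVERSE KINETIC ENERGY `T(q) = Σ_{μ∉{ν₀,ν₁}}(2 − 2Re χ_q(e_μ))` is `≥ 0`. [folklore] -/
theorem transverseKinetic_nonneg (ν₀ ν₁ : Fin (d + 1)) (q : Tor K) : 0 ≤ ∑ μ ∈ (Finset.univ.erase ν₀).erase ν₁, (2 - 2 * (chi K q (unitVec K μ)).re) :=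
  Finset.sum_nonneg fun μ _ => by
    have h := (Complex.abs_re_le_norm (chi K q (unitVec K μ))).trans (norm_chi_eq_one K q _).le
    linarith [(abs_le.mp h).2]

/-- `T(q) = Σ_{μ∉{ν₀,ν₁}}(2 − 2cos q′_μ)`. [cite: Balaban1984PropagatorsI, (1.29)–(1.31) p.23] -/
theorem transverseKinetic_eq_cos (ν₀ ν₁ : Fin (d + 1)) (q : Tor K) :
    ∑ μ ∈ (Finset.univ.erase ν₀).erase ν₁, (2 - 2 * (chi K q (unitVec K μ)).re) = ∑ μ ∈ (Finset.univ.erase ν₀).erase ν₁, (2 - 2 * Real.cos (sOf K q μ)) :=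
  Finset.sum_congr rfl fun μ _ => by rw [chi_unitVec_eq_exp, Complex.exp_ofReal_mul_I_re]

/-- ★★ **THE REAL FORM OF THE HARPER FIBRE**: for `ν₀ ≠ ν₁` and all `p, q`, `f : ℤ∕K_{ν₀} → ℂ`,
`Re Σ_j f̄_j(H_{p,q}f)_j = m²S + c(Σ_j|f(j+1)−f(j)|² + Σ_j(2 − 2Re ζ_j)|f_j|² + T(q)·S)`, `S = Σ|f_j|²`, `ζ_j = ψ(p_{ν₀}j)·χ_q(e_{ν₁})`: kinetic energy along `ν₀`, the Landau (Harper)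
potential from `ν₁`, and the transverse kinetic energy. [cite: King1986, (4.4) p.670, (4.35) p.674] -/
theorem re_form_harperOp_eq (c m2 : ℝ) {ν₀ ν₁ : Fin (d + 1)} (hν : ν₀ ≠ ν₁) (p q : Tor K) (f : ZMod (K ν₀) → ℂ) :
    (∑ j, conj (f j) * harperOp K c m2 ν₀ ν₁ p q f j).re
      = m2 * ∑ j, ‖f j‖ ^ 2 + c * (∑ j, ‖f (j + 1) - f j‖ ^ 2
          + ∑ j, (2 - 2 * ((ZMod.stdAddChar (N := K ν₀)) (p ν₀ * j) * chi K q (unitVec K ν₁)).re) * ‖f j‖ ^ 2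
          + (∑ μ ∈ (Finset.univ.erase ν₀).erase ν₁, (2 - 2 * (chi K q (unitVec K μ)).re)) * ∑ j, ‖f j‖ ^ 2) := by
  set R : ℂ := ∑ μ ∈ (Finset.univ.erase ν₀).erase ν₁, (chi K q (unitVec K μ) + conj (chi K q (unitVec K μ))) with hR
  set ζ : ZMod (K ν₀) → ℂ := fun j => (ZMod.stdAddChar (N := K ν₀)) (p ν₀ * j) * chi K q (unitVec K ν₁) with hζ
  -- pointwise real part
  have hpt : ∀ j, (conj (f j) * harperOp K c m2 ν₀ ν₁ p q f j).re
      = (m2 + 2 * ((d : ℝ) + 1) * c) * ‖f j‖ ^ 2 - c * ((conj (f j) * f (j + 1)).re + (conj (f j) * f (j - 1)).re + 2 * (ζ j).re * ‖f j‖ ^ 2 + R.re * ‖f j‖ ^ 2) := by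
    intro j
    have hH : harperOp K c m2 ν₀ ν₁ p q f j = ((m2 + 2 * ((d : ℝ) + 1) * c : ℝ) : ℂ) * f j - (c : ℂ) * ((f (j + 1) + f (j - 1)) + (ζ j + conj (ζ j)) * f j + R * f j) := by
      simp only [harperOp, hζ, hR, map_mul]
    rw [hH]
    exact re_conj_mul_harper_shape (f j) (f (j + 1)) (f (j - 1)) (ζ j) R _ c
  -- the real part of `R`
  have hRre : R.re = ∑ μ ∈ (Finset.univ.erase ν₀).erase ν₁, 2 * (chi K q (unitVec K μ)).re := by
    rw [hR, Complex.re_sum]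
    exact Finset.sum_congr rfl fun μ _ => by simp [Complex.add_re, Complex.conj_re]; ring
  rw [Complex.re_sum, Finset.sum_congr rfl fun j _ => hpt j, Finset.sum_sub_distrib, ← Finset.mul_sum, ← Finset.mul_sum, Finset.sum_add_distrib, Finset.sum_add_distrib,
    Finset.sum_add_distrib, sum_re_conj_mul_pred, ← Finset.mul_sum, sum_norm_sq_fwdDiff_eq, hRre]
  have hT : ∑ μ ∈ (Finset.univ.erase ν₀).erase ν₁, (2 - 2 * (chi K q (unitVec K μ)).re)
      = 2 * (((Finset.univ.erase ν₀).erase ν₁).card : ℝ) - ∑ μ ∈ (Finset.univ.erase ν₀).erase ν₁, 2 * (chi K q (unitVec K μ)).re := by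
    rw [Finset.sum_sub_distrib, Finset.sum_const, nsmul_eq_mul]; ring
  rw [hT, card_rest hν]
  have hζsum : ∑ j, (2 - 2 * (ζ j).re) * ‖f j‖ ^ 2 = 2 * ∑ j, ‖f j‖ ^ 2 - ∑ j, 2 * (ζ j).re * ‖f j‖ ^ 2 := by
    rw [Finset.mul_sum, ← Finset.sum_sub_distrib]; exact Finset.sum_congr rfl fun j _ => by ring
  simp only [hζ] at hζsum ⊢
  rw [hζsum]
  ring

/-! ## §3 Every fibre sits above the Landau level -/

/-- ★★★ **THE LANDAU LEVEL OF EVERY HARPER FIBRE**: `ν₀ ≠ ν₁`, `c ≥ 0`, all `p, q`, all `f`: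
`(m² + c·T(q) + c·Λ(p′_{ν₀}))·Σ_j|f_j|² ≤ Re Σ_j f̄_j(H_{p,q}f)_j` — the transverse kinetic energy `T(q) ≥ 0` and the lattice Landau level `Λ(θ) = |sin θ|∕2 − (1−cos θ)²∕4` add.
[cite: King1986, (4.4) p.670, (4.35) p.674] -/
theorem re_form_harperOp_ge_landau {c : ℝ} (hc : 0 ≤ c) (m2 : ℝ) {ν₀ ν₁ : Fin (d + 1)} (hν : ν₀ ≠ ν₁) (p q : Tor K) (f : ZMod (K ν₀) → ℂ) :
    (m2 + c * (∑ μ ∈ (Finset.univ.erase ν₀).erase ν₁, (2 - 2 * (chi K q (unitVec K μ)).re)) + c * landauGap (sOf K p ν₀)) * ∑ j, ‖f j‖ ^ 2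
      ≤ (∑ j, conj (f j) * harperOp K c m2 ν₀ ν₁ p q f j).re := by
  rw [re_form_harperOp_eq K c m2 hν p q f]
  set ζ : ZMod (K ν₀) → ℂ := fun j => (ZMod.stdAddChar (N := K ν₀)) (p ν₀ * j) * chi K q (unitVec K ν₁) with hζ
  have hζ1 : ∀ j, ‖ζ j‖ = 1 := fun j => by
    simp only [hζ]; rw [norm_mul, norm_chi_eq_one, mul_one, ZMod.stdAddChar_apply]; exact Circle.norm_coe _
  have hζs : ∀ j, ζ (j + 1) = Complex.exp ((sOf K p ν₀ : ℝ) * Complex.I) * ζ j := fun j => by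
    simp only [hζ]; rw [mul_add, mul_one, AddChar.map_add_eq_mul, ← chi_unitVec, chi_unitVec_eq_exp]; ring
  have hfib := landau_fibre_bound_gap f hζ1 hζs
  have hpot : ∑ j, ‖1 - ζ j‖ ^ 2 * ‖f j‖ ^ 2 = ∑ j, (2 - 2 * (ζ j).re) * ‖f j‖ ^ 2 := Finset.sum_congr rfl fun j _ => by rw [(norm_sq_one_sub_of_norm_eq_one (hζ1 j)).1]
  rw [hpot] at hfib
  simp only [hζ] at hfib
  have hS : 0 ≤ ∑ j, ‖f j‖ ^ 2 := Finset.sum_nonneg fun _ _ => sq_nonneg _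
  nlinarith [mul_le_mul_of_nonneg_left hfib hc, hS]

/-- ★★ The `q`-UNIFORM floor: every Harper fibre is bounded below by `(m² + cΛ(p′_{ν₀}))·Σ|f_j|²` (drop `T(q) ≥ 0`). [cite: King1986, (4.4) p.670] -/
theorem re_form_harperOp_ge_landau' {c : ℝ} (hc : 0 ≤ c) (m2 : ℝ) {ν₀ ν₁ : Fin (d + 1)} (hν : ν₀ ≠ ν₁) (p q : Tor K) (f : ZMod (K ν₀) → ℂ) :
    (m2 + c * landauGap (sOf K p ν₀)) * ∑ j, ‖f j‖ ^ 2 ≤ (∑ j, conj (f j) * harperOp K c m2 ν₀ ν₁ p q f j).re := by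
  have h := re_form_harperOp_ge_landau K hc m2 hν p q f
  have hT := transverseKinetic_nonneg K ν₀ ν₁ q
  have hS : 0 ≤ ∑ j, ‖f j‖ ^ 2 := Finset.sum_nonneg fun _ _ => sq_nonneg _
  nlinarith [mul_nonneg (mul_nonneg hc hT) hS]

end Form

end Summit.QuantumFields.YangMills.BalabanUVNodes.N15KingModelRung.Landau

end
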